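import Summits.Ventures.HodgeRepro2.T5TameCongruence
import Summits.Ventures.HodgeRepro2.T5DecompositionOrder

/-!
# T5DecompositionCyclic — «the decomposition group D_p = ⟨Frob_p⟩ is cyclic» (unramified p)

Seat p3 of the blind cell `pub-hodge-repro2` (Tier-5 support column for sub-step N2 of
`route/TIER5.md`).  A kernel witness behind the first clause of row N2.2.5 of
`route/T5-N2-route-3.md`: «for a rational prime `p` the decomposition group `D_p = ⟨Frob_p⟩` is
cyclic».  For a Galois number field `F/ℚ` and a prime `P` of `𝓞 F` above `p` with `e(P ∣ p) = 1`:

* the inertia group of `P` in `Gal(F/ℚ)` is trivial (`card_inertia_eq_ramificationIdxIn`);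
* hence `D_P = D_P / I_P ≅ Gal((𝓞 F ⧸ P) / (ℤ ⧸ p))` (`Ideal.Quotient.stabilizerQuotientInertiaEquiv`),
  the Galois group of an extension of finite fields, which is cyclic (generated by the Frobenius
  `x ↦ x^p`, Mathlib's `frobeniusAlgEquivOfAlgebraic`); so `D_P` is cyclic;
* `|D_P| = f(P ∣ p)` (`T5DecompositionOrder`), so `D_P` is generated by one element of order
  `f(P ∣ p)` — «`D_p = ⟨Frob_p⟩`, of order `f`».  The identification of that generator with the
  arithmetic Frobenius (Mathlib's `arithFrobAt`) is not made here and stays prose.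

Declaration of README §8(d): this file uses an L-value-free non-vanishing device: NO.
-/

namespace Summit.Ventures.HodgeRepro2.T5DecompositionCyclic

open NumberField Ideal
open scoped Pointwise

variable {F : Type*} [Field F] [NumberField F] [IsGalois ℚ F]
  {p : ℕ} (hp : p.Prime) (P : Ideal (𝓞 F)) [P.IsPrime] [P.LiesOver (span {(p : ℤ)})]

include hp in
/-- For `p` unramified at `P`, the inertia group of `P` in `Gal(F/ℚ)` is trivial. -/
theorem inertia_eq_bot_of_ramificationIdx_eq_one (he : P.ramificationIdx ℤ = 1) :
    P.inertia Gal(F/ℚ) = ⊥ := by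
  haveI := T5TameCongruence.isGaloisGroup_gal (F := F)
  haveI : (span {(p : ℤ)}).IsPrime :=
    (span_singleton_prime (by exact_mod_cast hp.ne_zero)).mpr (Nat.prime_iff_prime_int.mp hp)
  apply Subgroup.eq_bot_of_card_eq
  rw [card_inertia_eq_ramificationIdxIn (span {(p : ℤ)}) P,
    ramificationIdxIn_eq_ramificationIdx (span {(p : ℤ)}) P Gal(F/ℚ), he]

include hp in
/-- **The decomposition group of an unramified prime is cyclic.**  For `e(P ∣ p) = 1` the
stabiliser `D_P` of `P` in `Gal(F/ℚ)` is isomorphic to the Galois group of the residue-field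
extension `(𝓞 F ⧸ P) / (ℤ ⧸ p)`, a finite field over a finite field, hence cyclic. -/
theorem isCyclic_stabilizer_of_ramificationIdx_eq_one (he : P.ramificationIdx ℤ = 1) :
    IsCyclic (MulAction.stabilizer Gal(F/ℚ) P) := by
  haveI := T5TameCongruence.isGaloisGroup_gal (F := F)
  have hp0 : (p : ℤ) ≠ 0 := by exact_mod_cast hp.ne_zero
  haveI hpI : (span {(p : ℤ)}).IsPrime :=
    (span_singleton_prime hp0).mpr (Nat.prime_iff_prime_int.mp hp)
  have hspan_bot : (span {(p : ℤ)}) ≠ ⊥ := by rw [Ne, span_singleton_eq_bot]; exact hp0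
  haveI : (span {(p : ℤ)}).IsMaximal := hpI.isMaximal hspan_bot
  have hPbot : P ≠ ⊥ := ne_bot_of_liesOver_of_ne_bot hspan_bot P
  haveI : P.IsMaximal := Ideal.IsPrime.isMaximal inferInstance hPbot
  have hI : P.inertia (MulAction.stabilizer Gal(F/ℚ) P) = ⊥ := by
    rw [Subgroup.eq_bot_iff_forall]
    intro σ hσ
    have h1 : (σ : Gal(F/ℚ)) ∈ P.inertia Gal(F/ℚ) := Ideal.coe_mem_inertia.mpr hσ
    rw [inertia_eq_bot_of_ramificationIdx_eq_one hp P he, Subgroup.mem_bot] at h1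
    exact Subtype.ext h1
  letI : Field (ℤ ⧸ span {(p : ℤ)}) := Ideal.Quotient.field _
  letI : Field (𝓞 F ⧸ P) := Ideal.Quotient.field _
  haveI : Finite (𝓞 F ⧸ P) := Ring.HasFiniteQuotients.finiteQuotient hPbot
  have e := Ideal.Quotient.stabilizerQuotientInertiaEquiv Gal(F/ℚ) (span {(p : ℤ)}) P
  have f : MulAction.stabilizer Gal(F/ℚ) P ⧸ P.inertia (MulAction.stabilizer Gal(F/ℚ) P) ≃*
      MulAction.stabilizer Gal(F/ℚ) P :=
    (QuotientGroup.quotientMulEquivOfEq hI).trans QuotientGroup.quotientBot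
  exact isCyclic_of_surjective (f.toMonoidHom.comp e.symm.toMonoidHom)
    (f.surjective.comp e.symm.surjective)

include hp in
/-- For `p` unramified at `P`, `|D_P| = f(P ∣ p)`. -/
theorem card_stabilizer_eq_inertiaDeg_of_ramificationIdx_eq_one (he : P.ramificationIdx ℤ = 1) :
    Nat.card (MulAction.stabilizer Gal(F/ℚ) P) = P.inertiaDeg ℤ := by
  rw [T5DecompositionOrder.card_stabilizer_eq_ramificationIdx_mul_inertiaDeg hp P, he, one_mul]

include hp in
/-- **«D_p = ⟨Frob_p⟩, of order f».**  For `p` unramified at `P` there is a single element of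
`D_P` of order `f(P ∣ p)` generating `D_P` (the arithmetic Frobenius; its identification with
Mathlib's `arithFrobAt` is not made here). -/
theorem exists_generator_stabilizer (he : P.ramificationIdx ℤ = 1) :
    ∃ σ : MulAction.stabilizer Gal(F/ℚ) P,
      Subgroup.zpowers σ = ⊤ ∧ orderOf σ = P.inertiaDeg ℤ := by
  haveI := isCyclic_stabilizer_of_ramificationIdx_eq_one hp P he
  obtain ⟨σ, hσ⟩ := IsCyclic.exists_generator (α := MulAction.stabilizer Gal(F/ℚ) P)
  refine ⟨σ, ?_, ?_⟩
  · exact Subgroup.eq_top_iff' _ |>.mpr hσ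
  · rw [← card_stabilizer_eq_inertiaDeg_of_ramificationIdx_eq_one hp P he]
    exact orderOf_eq_card_of_forall_mem_zpowers hσ

end Summit.Ventures.HodgeRepro2.T5DecompositionCyclic
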